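import Literature.NumberTheory.Transcendental.ZariskiDimCoordRelations
import Literature.Analysis.Complex.LaurentExpansionEval
import Literature.FieldTheory.TranscendenceDegree.AlgebraicDependenceBookkeeping
import Mathlib.Analysis.Complex.Polynomial.Basic
import HarnessLib

/-!
# Laurent expansions of the coordinates of a branch in a set of dimension `< 2`

Let `W ⊆ ℂ² × ℂ²` have `zariskiDim ℂ W < 2` and let `t ↦ ((f₀ t, f₁ t), (g₀ t, g₁ t))` be a germ of
curve with meromorphic coordinates (`t^{K} · f(t)` analytic at `0`) lying in `W` for `t` in a
punctured neighbourhood of `0`. Every pair of coordinates of `W` satisfies a non-trivial polynomial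
relation (`ZariskiDimCoordRelations`), which passes to the Laurent expansions
`𝓛[K, f] ∈ ℂ⸨X⸩` (`LaurentExpansionEval`); so if the expansion of `f₀` is transcendental over `ℂ`
(e.g. has a pole), the expansions of `f₁, g₀, g₁` are algebraic over `ℂ[f̂₀]`
(`isAlgebraic_coords_of_branch`): the function-field statement "`trdeg_ℂ ℂ(branch) = 1`" in the
form consumed by the Ax–Schanuel step. Also: Laurent series with a non-zero coefficient in
non-zero degree are transcendental over `ℂ` (`transcendental_of_coeff_ne_zero`). PROVED, no
definition (local notations `𝓣[·]`, `𝓛[·, ·]` as in `LaurentExpansionGerms`). [folklore]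
-/

noncomputable section

open Complex Filter Topology Set PowerSeries HahnSeries LaurentSeries MvPolynomial

namespace Literature.NumberTheory.Transcendental

open Literature.Analysis.Complex.LaurentGerm (aeval_laurent_eq_zero)
open Literature.FieldTheory.TranscendenceDegree (isAlgebraic_adjoin_singleton_of_aeval_eq_zero
  mem_range_algebraMap_of_isAlgebraic)
open Literature.RingTheory.PowerSeries (algebraMap_laurentSeries_apply)

/-- The Taylor series of `f : ℂ → ℂ` at `0`, as a formal power series (local notation). -/
local notation3 "𝓣[" f "]" =>
  (PowerSeries.mk fun n => ((Nat.factorial n : ℂ)⁻¹ * iteratedDeriv n f 0) : PowerSeries ℂ)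

/-- The Laurent expansion at `0` of a germ `f` with `zⁿ f(z)` analytic at `0` (local notation). -/
local notation3 "𝓛[" n ", " f "]" =>
  (HahnSeries.single (-((n : ℕ) : ℤ)) (1 : ℂ) *
    HahnSeries.ofPowerSeries ℤ ℂ 𝓣[fun z : ℂ => z ^ (n : ℕ) * (f : ℂ → ℂ) z] : LaurentSeries ℂ)

/-- **Laurent series with a non-constant term are transcendental over `ℂ`.** [folklore] -/
theorem transcendental_of_coeff_ne_zero {x : LaurentSeries ℂ} {n : ℤ} (hn : n ≠ 0)
    (hx : x.coeff n ≠ 0) : Transcendental ℂ x := by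
  intro halg
  obtain ⟨c, hc⟩ := mem_range_algebraMap_of_isAlgebraic halg
  rw [algebraMap_laurentSeries_apply] at hc
  rw [← hc, HahnSeries.C_apply, HahnSeries.coeff_single_of_ne hn] at hx
  exact hx rfl

/-- **Coordinates of a branch in a set of dimension `< 2` are algebraic over `ℂ[f̂₀]`.** For a
germ of curve `t ↦ ((f₀, f₁), (g₀, g₁))(t) ∈ W` (`t ≠ 0` small) with meromorphic coordinates and
`f̂₀ = 𝓛[K₀, f₀]` transcendental over `ℂ`, the Laurent expansions of `f₁, g₀, g₁` are algebraic over
`ℂ[f̂₀]`. [folklore] -/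
theorem isAlgebraic_coords_of_branch {W : Set (Fin 2 ⊕ Fin 2 → ℂ)} (hdim : zariskiDim ℂ W < 2)
    {f₀ f₁ g₀ g₁ : ℂ → ℂ} {K₀ K₁ K₂ K₃ : ℕ}
    (h₀ : AnalyticAt ℂ (fun t : ℂ => t ^ K₀ * f₀ t) 0) (h₁ : AnalyticAt ℂ (fun t : ℂ => t ^ K₁ * f₁ t) 0)
    (h₂ : AnalyticAt ℂ (fun t : ℂ => t ^ K₂ * g₀ t) 0) (h₃ : AnalyticAt ℂ (fun t : ℂ => t ^ K₃ * g₁ t) 0)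
    (hW : ∀ᶠ t in 𝓝[≠] (0 : ℂ), (Sum.elim ![f₀ t, f₁ t] ![g₀ t, g₁ t] : Fin 2 ⊕ Fin 2 → ℂ) ∈ W)
    (htr : Transcendental ℂ 𝓛[K₀, f₀]) :
    IsAlgebraic (Algebra.adjoin ℂ ({𝓛[K₀, f₀]} : Set (LaurentSeries ℂ))) 𝓛[K₁, f₁] ∧
    IsAlgebraic (Algebra.adjoin ℂ ({𝓛[K₀, f₀]} : Set (LaurentSeries ℂ))) 𝓛[K₂, g₀] ∧
    IsAlgebraic (Algebra.adjoin ℂ ({𝓛[K₀, f₀]} : Set (LaurentSeries ℂ))) 𝓛[K₃, g₁] := by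
  obtain ⟨P₁, hP₁, hrel₁⟩ := exists_relation_pair_of_zariskiDim_lt_two W hdim (Sum.inl 0) (Sum.inl 1)
  obtain ⟨P₂, hP₂, hrel₂⟩ := exists_relation_pair_of_zariskiDim_lt_two W hdim (Sum.inl 0) (Sum.inr 0)
  obtain ⟨P₃, hP₃, hrel₃⟩ := exists_relation_pair_of_zariskiDim_lt_two W hdim (Sum.inl 0) (Sum.inr 1)
  have e₁ : ∀ᶠ t in 𝓝[≠] (0 : ℂ), MvPolynomial.eval ![f₀ t, f₁ t] P₁ = 0 := by
    filter_upwards [hW] with t ht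
    exact hrel₁ (Sum.elim ![f₀ t, f₁ t] ![g₀ t, g₁ t]) ht
  have e₂ : ∀ᶠ t in 𝓝[≠] (0 : ℂ), MvPolynomial.eval ![f₀ t, g₀ t] P₂ = 0 := by
    filter_upwards [hW] with t ht
    exact hrel₂ (Sum.elim ![f₀ t, f₁ t] ![g₀ t, g₁ t]) ht
  have e₃ : ∀ᶠ t in 𝓝[≠] (0 : ℂ), MvPolynomial.eval ![f₀ t, g₁ t] P₃ = 0 := by
    filter_upwards [hW] with t ht
    exact hrel₃ (Sum.elim ![f₀ t, f₁ t] ![g₀ t, g₁ t]) ht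
  have a₁ := aeval_laurent_eq_zero h₀ h₁ P₁ e₁
  have a₂ := aeval_laurent_eq_zero h₀ h₂ P₂ e₂
  have a₃ := aeval_laurent_eq_zero h₀ h₃ P₃ e₃
  exact ⟨isAlgebraic_adjoin_singleton_of_aeval_eq_zero hP₁ a₁ htr,
    isAlgebraic_adjoin_singleton_of_aeval_eq_zero hP₂ a₂ htr,
    isAlgebraic_adjoin_singleton_of_aeval_eq_zero hP₃ a₃ htr⟩

end Literature.NumberTheory.Transcendental

end
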